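import Summits.CriticalPhenomena.PercolationContinuityZ3.Theorems.Transplant.TriFilmSKPath
import HarnessLib

/-!
# Triangular film `𝕋 × {0,1}`, V: CERTIFIED TERMINALS PASS THE BITBOARD FILTER

builds on p205010 (kernel theorem, internal audit signed; external expert review pending) — NOT used in this file.  Lane `prim-bschramm`, seat
`prim-bschramm-p2` (gen 39; class C1b; memo `HOME/bschramm/P2-LATTICES.md` §138); helper file (`--supports stmt-CriticalPhenomena-4575 --as helper`).
«Slab111SK4Terms» for the triangular films: a terminal triple `(E₁, E₂, w')` certified by `HexShadow.Terminals 3 z t_R t_D s_R (WsetT C z) E₁ E₂ w'`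
(«HexShadowVRouteData») consists of index vertices `vtxT e₁, vtxT e₂, vtxT w` with `e₁ ≠ e₂` in the terminal list `C.esList` and the bit `w` set in the need mask
`C.needMask e₁ e₂` («TriFilmSKDefs»): **`terminals_sound`**.
[cite: DuminilCopinSidoraviciusTassion2016, §2.3 (proof of Fact 2: u', v', w')]
-/

noncomputable section

namespace Summit.CriticalPhenomena.PercolationContinuityZ3.Theorems.Transplant

open Literature.Probability.Percolation Literature.Probability.LatticeModels SimpleGraph
open scoped Classical

namespace TriFilm.SKT

open Slab111.SK (bitOf sdiff maskBelow maskOfList endsOK orFold rd rdMask testBit_bitOf testBit_sdiff testBit_maskBelow of_testBit_maskBelow testBit_maskBelow_of testBit_orFold)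

variable {C : CtxT} {z : Site 2}

/-! ## §1 Neighbour lists -/

/-- An `AdjRelT`-neighbour in the universe is listed by `nbrList`. [folklore] -/
theorem mem_nbrList {e j : ℕ} (hj : C.validB j = true) (h : AdjRelT e j) : j ∈ C.nbrList e := by
  unfold CtxT.nbrList
  rw [List.mem_filter]
  refine ⟨?_, by rw [adjBT_iff.2 h, (testBit_univ_iff C j).2 hj]; rfl⟩
  unfold AdjRelT at h
  simp only [List.mem_cons, List.not_mem_nil, or_false]
  omega

/-- Members of `nbrList` are valid `AdjRelT`-neighbours. [folklore] -/
theorem of_mem_nbrList {e j : ℕ} (h : j ∈ C.nbrList e) : C.validB j = true ∧ AdjRelT e j := by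
  unfold CtxT.nbrList at h
  rw [List.mem_filter, Bool.and_eq_true] at h
  exact ⟨(testBit_univ_iff C j).1 h.2.2, adjBT_iff.1 h.2.1⟩

/-- An outside window neighbour is listed by `outs`. [folklore] -/
theorem mem_outs {e j : ℕ} (hj : C.validB j = true) (h : AdjRelT e j) (hwin : C.inWinB j = true) (hW : C.W.testBit j = false) : j ∈ C.outs e := by
  unfold CtxT.outs
  rw [List.mem_filter]
  exact ⟨mem_nbrList hj h, by rw [(testBit_win_iff C j).2 hwin, hW]; rfl⟩

/-- A window neighbour is listed by `ins`. [folklore] -/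
theorem mem_ins {e j : ℕ} (hj : C.validB j = true) (h : AdjRelT e j) (hwin : C.inWinB j = true) : j ∈ C.ins e := by
  unfold CtxT.ins
  rw [List.mem_filter]
  exact ⟨mem_nbrList hj h, (testBit_win_iff C j).2 hwin⟩

/-- Members of `outs` are valid. [folklore] -/
theorem validB_of_mem_outs {C : CtxT} {e j : ℕ} (h : j ∈ C.outs e) : C.validB j = true := by
  unfold CtxT.outs at h; rw [List.mem_filter] at h; exact (of_mem_nbrList h.1).1

/-- Members of `ins` are valid. [folklore] -/
theorem validB_of_mem_ins {C : CtxT} {e j : ℕ} (h : j ∈ C.ins e) : C.validB j = true := by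
  unfold CtxT.ins at h; rw [List.mem_filter] at h; exact (of_mem_nbrList h.1).1

/-- Membership in the terminal list. [folklore] -/
theorem mem_esList {C : CtxT} {e : ℕ} (hv : C.validB e = true) (hWR : C.WR.testBit e = true) (hcen : C.cen.testBit e = false) {j : ℕ} (hj : j ∈ C.outs e) :
    e ∈ C.esList := by
  unfold CtxT.esList
  rw [List.mem_filter, List.mem_range]
  refine ⟨((validB_iff C e).1 hv).1, ?_⟩
  rw [hWR, hcen]
  have : (C.outs e).isEmpty = false := by
    cases h : C.outs e with
    | nil => rw [h] at hj; simp at hj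
    | cons _ _ => rfl
  rw [this]; rfl

/-- Boolean inequality from distinct index vertices. [folklore] -/
theorem bne_of_vtx_ne {i j : ℕ} (h : vtxT C.k z i ≠ vtxT C.k z j) : (i != j) = true := by
  rw [bne_iff_ne]; rintro rfl; exact h rfl

/-! ## §2 Certified terminals pass the filter -/

/-- **CERTIFIED TERMINALS PASS THE BITBOARD FILTER.**  [cite: DuminilCopinSidoraviciusTassion2016, §2.3 (proof of Fact 2: u', v', w')] -/
theorem terminals_sound (hk : C.k ≤ 9) {tR tD sR : ℕ} (htR : C.tR = min tR 3) (hsR : C.sR = min sR 3)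
    (hwT : tD ≤ C.wT ∨ 4 ≤ C.wT) (hwS : sR ≤ C.wS ∨ 4 ≤ C.wS) {E₁ E₂ w' : triFilm C.k}
    (hT : (hexShadow C.k).Terminals 3 z tR tD sR (WsetT C z) E₁ E₂ w') :
    ∃ e1 e2 w, C.validB e1 = true ∧ C.validB e2 = true ∧ C.validB w = true ∧ vtxT C.k z e1 = E₁ ∧ vtxT C.k z e2 = E₂ ∧ vtxT C.k z w = w' ∧
      C.WR.testBit e1 = true ∧ C.WR.testBit e2 = true ∧ C.W.testBit w = true ∧
      e1 ∈ C.esList ∧ e2 ∈ C.esList ∧ e1 ≠ e2 ∧ (C.needMask e1 e2).testBit w = true := by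
  obtain ⟨e1, hv1, hW1, rfl⟩ := exists_idx_of_mem_Wset hT.E₁W
  obtain ⟨e2, hv2, hW2, rfl⟩ := exists_idx_of_mem_Wset hT.E₂W
  obtain ⟨w, hvw, hWw, rfl⟩ := exists_idx_of_mem_Wset hT.w'W
  have hne : e1 ≠ e2 := fun h => hT.ne (by rw [h])
  -- rerouting block and centre
  have hR1 : C.inRB e1 = true := (inRB_iff_mem_blkR hv1 htR hsR).2 hT.E₁R
  have hR2 : C.inRB e2 = true := (inRB_iff_mem_blkR hv2 htR hsR).2 hT.E₂R
  have hWR1 : C.WR.testBit e1 = true := (testBit_WR_iff C e1).2 ⟨hW1, hR1⟩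
  have hWR2 : C.WR.testBit e2 = true := (testBit_WR_iff C e2).2 ⟨hW2, hR2⟩
  have h31 := triNorm_le_three_of_inRB (z := z) hR1
  have h32 := triNorm_le_three_of_inRB (z := z) hR2
  have cenFalse : ∀ {i : ℕ}, C.validB i = true → (hexShadow C.k).sh (vtxT C.k z i) ≠ z → C.cen.testBit i = false := by
    intro i hv hne'
    rw [Bool.eq_false_iff]
    intro h
    exact hne' ((cenB_iff hv).1 ((testBit_cen_iff C i).1 h))
  have hc1 : C.cen.testBit e1 = false := cenFalse hv1 hT.E₁z
  have hc2 : C.cen.testBit e2 = false := cenFalse hv2 hT.E₂z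
  have hcw : C.cen.testBit w = false := cenFalse hvw hT.w'z
  -- the four γ-neighbours
  obtain ⟨o₁, a₁, a₂, o₂, ho1, ha1, ha2, ho2, ho1W, ho2W, hwo1, hwa1, hwa2, hwo2, hn1, hn2, hn3, hn4, hn5, hn6, hn7, hn8, hc01, hca1, hca2, hco2⟩ :=
    hT.nbrs
  obtain ⟨jo1, hvo1, rfl, hro1⟩ := exists_idx_of_adj hk hv1 h31 ho1.symm
  obtain ⟨ja1, hva1, rfl, hra1⟩ := exists_idx_of_adj hk hv1 h31 ha1
  obtain ⟨ja2, hva2, rfl, hra2⟩ := exists_idx_of_adj hk hv2 h32 ha2.symm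
  obtain ⟨jo2, hvo2, rfl, hro2⟩ := exists_idx_of_adj hk hv2 h32 ho2
  have hWo1 : C.W.testBit jo1 = false := by rw [Bool.eq_false_iff]; intro h; exact ho1W ((vtx_mem_Wset_iff hvo1).2 h)
  have hWo2 : C.W.testBit jo2 = false := by rw [Bool.eq_false_iff]; intro h; exact ho2W ((vtx_mem_Wset_iff hvo2).2 h)
  have mo1 : jo1 ∈ C.outs e1 := mem_outs hvo1 hro1 (inWinB_of_inWin hvo1 hwT hwS hwo1) hWo1
  have ma1 : ja1 ∈ C.ins e1 := mem_ins hva1 hra1 (inWinB_of_inWin hva1 hwT hwS hwa1)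
  have mo2 : jo2 ∈ C.outs e2 := mem_outs hvo2 hro2 (inWinB_of_inWin hvo2 hwT hwS hwo2) hWo2
  have ma2 : ja2 ∈ C.ins e2 := mem_ins hva2 hra2 (inWinB_of_inWin hva2 hwT hwS hwa2)
  refine ⟨e1, e2, w, hv1, hv2, hvw, rfl, rfl, rfl, hWR1, hWR2, hWw, mem_esList hv1 hWR1 hc1 mo1, mem_esList hv2 hWR2 hc2 mo2, hne, ?_⟩
  -- the need mask
  unfold CtxT.needMask
  rw [testBit_orFold]
  refine ⟨jo1, mo1, ?_⟩
  rw [testBit_orFold]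
  refine ⟨ja1, ma1, ?_⟩
  rw [testBit_orFold]
  refine ⟨jo2, mo2, ?_⟩
  rw [testBit_orFold]
  refine ⟨ja2, ma2, ?_⟩
  have hq : C.quadOK e1 e2 jo1 ja1 jo2 ja2 = true := by
    unfold CtxT.quadOK
    simp only [Bool.and_eq_true, Bool.or_eq_true]
    refine ⟨⟨⟨⟨⟨⟨⟨bne_of_vtx_ne hn1, bne_of_vtx_ne hn2⟩, bne_of_vtx_ne (Ne.symm hn5)⟩, bne_of_vtx_ne (Ne.symm hn7)⟩, bne_of_vtx_ne hn3⟩,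
      bne_of_vtx_ne hn4⟩, bne_of_vtx_ne (Ne.symm hn6)⟩, ?_⟩
    by_cases h12 : ja1 = ja2
    · right
      exact (testBit_cen_iff C ja1).2 ((cenB_iff hva1).2 (hn8 (by rw [h12])))
    · left; exact bne_iff_ne.2 h12
  rw [hq, cond_true]
  have colFalse : ∀ {e : ℕ}, C.validB e = true → (hexShadow C.k).sh (vtxT C.k z w) ≠ (hexShadow C.k).sh (vtxT C.k z e) →
      (C.colM e).testBit w = false := by
    intro e _ hne'
    rw [Bool.eq_false_iff]
    intro h
    exact hne' ((testBit_colM_iff_sh hvw).1 h)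
  simp only [testBit_sdiff, Nat.testBit_lor, hWw, hcw, colFalse hv1 hT.w'E₁, colFalse hv2 hT.w'E₂,
    colFalse hvo1 hc01, colFalse hva1 hca1, colFalse hva2 hca2, colFalse hvo2 hco2, Bool.or_false, Bool.not_false, Bool.and_true]

end TriFilm.SKT

end Summit.CriticalPhenomena.PercolationContinuityZ3.Theorems.Transplant

end
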